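import Summits.QuantumFields.YangMills.Theorems.LuscherReductionOneSiteLevelsIMS
import Summits.QuantumFields.YangMills.Theorems.FemtoTransferGapSlabRayleigh
import HarnessLib

/-!
# The PRODUCT (ground-state transformation) identity for the transfer form: `⟨gη, K gη⟩ = ⟨g²η, Kη⟩ − ½∫∫ η(U)K(U,V)η(V)(g(U) − g(V))²`
# (support module for crux `DressedRitz` stmt-QuantumFields-20205, route `LuscherReduction`, line «polyakovlift» r6 — F8 «energy-norm
# product lemma» of the LEAD's plan `R6-DESIGN.md` §3(d); fleet seat prover ym-infvol-p1 g7, `--supports stmt-QuantumFields-20205`)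

Companion of `Theorems/LuscherReductionOneSiteLevelsIMS.lean` (`ims_identity` / `qform_le_sum_localized_add`: the IMS formula for a
quadratic PARTITION OF UNITY `Σ J_a² = 1`).  The r6 proof plan for S-PSCAL″ (step (d), the SOFT ERROR) multiplies the vacuum defect `η`
of the one-site model at coupling `B` by ONE bounded observable `g∘powLink L` and needs the energy functional `P(u) = μ₀‖u‖² − ⟨u,Ku⟩` of the
product.  For a symmetric kernel the exact identity is the kernel form of the ground-state transformation / Jacobi identity

  `⟨gη, K_β(gη)⟩ = ⟨g²η, K_β η⟩ − ½ ∫∫ η(U) K_β(U,V) η(V) (g(U) − g(V))² d(μ⊗μ)`                    (`qform_mul_mul_eq`)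

(pointwise `g(U)g(V) = ½(g(U)² + g(V)²) − ½(g(U) − g(V))²` and the `U ↔ V` symmetry of `η(U)K(U,V)η(V)`), whence for every level `s`

  `s‖gη‖² − ⟨gη,K(gη)⟩ = (s⟨g²η,η⟩ − ⟨g²η,Kη⟩) + ½ ∫∫ ηKη (g(U) − g(V))²`                              (`energy_mul_eq`)

and, with a DEFECT-ROW bound `∫ K_β(U,V)(g(U) − g(V))² dV ≤ M` uniform in `U` (for a link-Lipschitz `g` this is `Lip(g)²·M₂(β)`, the
second link moment — `…LatticeIMSDefect.lean` / `…OneSiteLevelsLinkMoments.lean`), the one-sided estimates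

  `⟨gη, K(gη)⟩ ≥ ⟨g²η, Kη⟩ − ½ M ‖η‖²`,   `s‖gη‖² − ⟨gη,K(gη)⟩ ≤ (s⟨g²η,η⟩ − ⟨g²η,Kη⟩) + ½ M ‖η‖²`     (`qform_mul_mul_ge`, `energy_mul_le`)

(`η(U)η(V) ≤ ½(η(U)² + η(V)²)` against the non-negative weight).  §1 is typed for every `L`, `β`, every continuous representation of a
compact second-countable group with symmetric kernel; §2 specialises to the `SU(2)` kernel of the leaves (`transferKernel_su2Rep_symm`) and
rewrites `⟨g²η, Kη⟩ = ⟨g²η, transferApply β η⟩_{L²}` (`qform_eq_l2_transferApply`), the operator currency of the LEAD's plan.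

## WHAT THIS IS NOT
No bound on `M`, no choice of `g`; NOT a stub of the crux; conditional femto rung R2b1; not infinite volume, NOT THE CLAY GAP.
Sorry-free; no new definition, no named fact.  References: B. Simon, Ann. Phys. 146 (1983) §3 [cite: SimonB1983DiscreteSpectrum, §3];
E. H. Lieb, M. Loss, *Analysis*, Thm. 7.8 [cite: LiebLoss2001, Thm. 7.8]; M. Lüscher, NPB 219 (1983) [cite: Luscher1983, §3].
-/

set_option autoImplicit false

noncomputable section

open MeasureTheory Filter Topology Real
open Literature.MathematicalPhysics.QuantumFieldTheory
open Literature.MathematicalPhysics.QuantumLattice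
open scoped BigOperators

namespace Summit.QuantumFields.YangMills.Theorems.FemtoTransferGap

section Generic

variable {N : ℕ} {G : Type*} [Group G] [TopologicalSpace G] [IsTopologicalGroup G] [CompactSpace G]
  [MeasurableSpace G] [BorelSpace G] [SecondCountableTopology G]
variable (ρ : G →* Matrix (Fin N) (Fin N) ℂ)

omit [TopologicalSpace G] [IsTopologicalGroup G] [CompactSpace G] [BorelSpace G] [SecondCountableTopology G] in
/-- The square of a bounded invariant multiplier is a bounded invariant multiplier; `g²η` is physical. [folklore] -/
theorem IsPhys.sq_mul_of_invariant {L : ℕ} {g η : GaugeConfig 3 L G → ℝ} (hη : IsPhys η) (hgm : Measurable g)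
    {Cg : ℝ} (hgb : ∀ U, |g U| ≤ Cg)
    (hgg : ∀ (k : Site 3 L → G) (U : GaugeConfig 3 L G), g (gaugeTransform k U) = g U)
    (hgz : ∀ (k : Fin 3), ∀ z ∈ Subgroup.center G, ∀ U : GaugeConfig 3 L G, g (twist k z U) = g U) :
    IsPhys (fun U => g U ^ 2 * η U) :=
  hη.mul_of_invariant (hgm.pow_const 2) (CJ := Cg ^ 2)
    (fun U => by rw [abs_pow]; exact pow_le_pow_left₀ (abs_nonneg _) (hgb U) 2)
    (fun k U => by rw [hgg k U]) (fun k z hz U => by rw [hgz k z hz U])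

/-- ★ **The product identity for the transfer form (symmetric kernel).**  For a bounded measurable gauge- and twist-invariant
multiplier `g` and a physical `η`:
`⟨gη, K_β(gη)⟩ = ⟨g²η, K_β η⟩ − ½ ∫ η(U) K_β(U,V) η(V) (g(U) − g(V))² d(μ⊗μ)` — the kernel form of the ground-state transformation
(`g(U)g(V) = ½(g(U)²+g(V)²) − ½(g(U)−g(V))²`, and `∫∫ ηKη g(U)² = ∫∫ ηKη g(V)²` by symmetry). [cite: SimonB1983DiscreteSpectrum, §3] [cite: LiebLoss2001, Thm. 7.8] -/
theorem qform_mul_mul_eq {L : ℕ} [NeZero L] (hρ : Continuous ρ) (β : ℝ)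
    (hsymm : ∀ U V : GaugeConfig 3 L G, transferKernel ρ β U V = transferKernel ρ β V U)
    {g : GaugeConfig 3 L G → ℝ} (hgm : Measurable g) {Cg : ℝ} (hgb : ∀ U, |g U| ≤ Cg)
    (hgg : ∀ (k : Site 3 L → G) (U : GaugeConfig 3 L G), g (gaugeTransform k U) = g U)
    (hgz : ∀ (k : Fin 3), ∀ z ∈ Subgroup.center G, ∀ U : GaugeConfig 3 L G, g (twist k z U) = g U)
    {η : GaugeConfig 3 L G → ℝ} (hη : IsPhys η) :
    qform ρ β (fun U => g U * η U) (fun U => g U * η U)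
      = qform ρ β (fun U => g U ^ 2 * η U) η
        - (1 / 2) * ∫ p, η p.1 * transferKernel ρ β p.1 p.2 * η p.2 * (g p.1 - g p.2) ^ 2
            ∂(configMeasure G L).prod (configMeasure G L) := by
  set Pm := (configMeasure G L).prod (configMeasure G L) with hPm
  have hCg : 0 ≤ Cg := (abs_nonneg _).trans (hgb (1 : GaugeConfig 3 L G))
  have hgη : IsPhys (fun U => g U * η U) := hη.mul_of_invariant hgm hgb hgg hgz
  have hg2η : IsPhys (fun U => g U ^ 2 * η U) := hη.sq_mul_of_invariant hgm hgb hgg hgz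
  -- the four weights and their integrability against `η(U) K η(V)`
  have hm1 : Measurable fun p : GaugeConfig 3 L G × GaugeConfig 3 L G => g p.1 := hgm.comp measurable_fst
  have hm2 : Measurable fun p : GaugeConfig 3 L G × GaugeConfig 3 L G => g p.2 := hgm.comp measurable_snd
  have hw12 : Integrable (fun p : GaugeConfig 3 L G × GaugeConfig 3 L G =>
      η p.1 * transferKernel ρ β p.1 p.2 * η p.2 * (g p.1 * g p.2)) Pm :=
    integrable_qformIntegrand_mul ρ hρ β hη hη (hm1.mul hm2) (Cg := Cg * Cg) fun p => by
      rw [abs_mul]; exact mul_le_mul (hgb p.1) (hgb p.2) (abs_nonneg _) hCg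
  have hw11 : Integrable (fun p : GaugeConfig 3 L G × GaugeConfig 3 L G =>
      η p.1 * transferKernel ρ β p.1 p.2 * η p.2 * g p.1 ^ 2) Pm :=
    integrable_qformIntegrand_mul ρ hρ β hη hη (hm1.pow_const 2) (Cg := Cg ^ 2) fun p => by
      rw [abs_pow]; exact pow_le_pow_left₀ (abs_nonneg _) (hgb p.1) 2
  have hw22 : Integrable (fun p : GaugeConfig 3 L G × GaugeConfig 3 L G =>
      η p.1 * transferKernel ρ β p.1 p.2 * η p.2 * g p.2 ^ 2) Pm :=
    integrable_qformIntegrand_mul ρ hρ β hη hη (hm2.pow_const 2) (Cg := Cg ^ 2) fun p => by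
      rw [abs_pow]; exact pow_le_pow_left₀ (abs_nonneg _) (hgb p.2) 2
  have hwD : Integrable (fun p : GaugeConfig 3 L G × GaugeConfig 3 L G =>
      η p.1 * transferKernel ρ β p.1 p.2 * η p.2 * (g p.1 - g p.2) ^ 2) Pm :=
    integrable_qformIntegrand_mul ρ hρ β hη hη ((hm1.sub hm2).pow_const 2) (Cg := (2 * Cg) ^ 2) fun p => by
      rw [abs_pow]
      refine pow_le_pow_left₀ (abs_nonneg _) ((abs_sub _ _).trans ?_) 2
      linarith [hgb p.1, hgb p.2]
  -- the two forms as product integrals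
  have hL : qform ρ β (fun U => g U * η U) (fun U => g U * η U)
      = ∫ p, η p.1 * transferKernel ρ β p.1 p.2 * η p.2 * (g p.1 * g p.2) ∂Pm := by
    rw [qform_eq_integral_prod ρ hρ β hgη hgη]
    exact integral_congr_ae (ae_of_all _ fun p => by simp only; ring)
  have hR : qform ρ β (fun U => g U ^ 2 * η U) η = ∫ p, η p.1 * transferKernel ρ β p.1 p.2 * η p.2 * g p.1 ^ 2 ∂Pm := by
    rw [qform_eq_integral_prod ρ hρ β hg2η hη]
    exact integral_congr_ae (ae_of_all _ fun p => by simp only; ring)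
  -- symmetry: `∫ ηKη g(V)² = ∫ ηKη g(U)²`
  have hswap : ∫ p, η p.1 * transferKernel ρ β p.1 p.2 * η p.2 * g p.2 ^ 2 ∂Pm
      = ∫ p, η p.1 * transferKernel ρ β p.1 p.2 * η p.2 * g p.1 ^ 2 ∂Pm := by
    have h := integral_prod_swap (μ := configMeasure G L) (ν := configMeasure G L)
      (fun p : GaugeConfig 3 L G × GaugeConfig 3 L G => η p.1 * transferKernel ρ β p.1 p.2 * η p.2 * g p.1 ^ 2)
    rw [← h]
    refine integral_congr_ae (ae_of_all _ fun p => ?_)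
    simp only [Prod.fst_swap, Prod.snd_swap]
    rw [hsymm p.2 p.1]
    ring
  -- pointwise `g(U)g(V) = ½g(U)² + ½g(V)² − ½(g(U)−g(V))²`, integrated
  have hsplit : ∫ p, η p.1 * transferKernel ρ β p.1 p.2 * η p.2 * (g p.1 * g p.2) ∂Pm
      = (1 / 2) * ∫ p, η p.1 * transferKernel ρ β p.1 p.2 * η p.2 * g p.1 ^ 2 ∂Pm
        + (1 / 2) * ∫ p, η p.1 * transferKernel ρ β p.1 p.2 * η p.2 * g p.2 ^ 2 ∂Pm
        - (1 / 2) * ∫ p, η p.1 * transferKernel ρ β p.1 p.2 * η p.2 * (g p.1 - g p.2) ^ 2 ∂Pm := by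
    have e : ∫ p, η p.1 * transferKernel ρ β p.1 p.2 * η p.2 * (g p.1 * g p.2) ∂Pm
        = ∫ p, ((1 / 2) * (η p.1 * transferKernel ρ β p.1 p.2 * η p.2 * g p.1 ^ 2)
            + (1 / 2) * (η p.1 * transferKernel ρ β p.1 p.2 * η p.2 * g p.2 ^ 2))
            - (1 / 2) * (η p.1 * transferKernel ρ β p.1 p.2 * η p.2 * (g p.1 - g p.2) ^ 2) ∂Pm :=
      integral_congr_ae (ae_of_all _ fun p => by simp only; ring)
    have hI1 : Integrable (fun p : GaugeConfig 3 L G × GaugeConfig 3 L G =>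
        (1 / 2 : ℝ) * (η p.1 * transferKernel ρ β p.1 p.2 * η p.2 * g p.1 ^ 2)) Pm := hw11.const_mul _
    have hI2 : Integrable (fun p : GaugeConfig 3 L G × GaugeConfig 3 L G =>
        (1 / 2 : ℝ) * (η p.1 * transferKernel ρ β p.1 p.2 * η p.2 * g p.2 ^ 2)) Pm := hw22.const_mul _
    have hI3 : Integrable (fun p : GaugeConfig 3 L G × GaugeConfig 3 L G =>
        (1 / 2 : ℝ) * (η p.1 * transferKernel ρ β p.1 p.2 * η p.2 * (g p.1 - g p.2) ^ 2)) Pm := hwD.const_mul _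
    have hI12 : Integrable (fun p : GaugeConfig 3 L G × GaugeConfig 3 L G =>
        (1 / 2 : ℝ) * (η p.1 * transferKernel ρ β p.1 p.2 * η p.2 * g p.1 ^ 2)
          + (1 / 2 : ℝ) * (η p.1 * transferKernel ρ β p.1 p.2 * η p.2 * g p.2 ^ 2)) Pm := hI1.add hI2
    rw [e, integral_sub hI12 hI3, integral_add hI1 hI2, integral_const_mul, integral_const_mul, integral_const_mul]
  rw [hL, hR, hsplit, hswap]
  ring

/-- ★ **Product inequality (defect-row bound).**  Under the hypotheses of `qform_mul_mul_eq`, if `M` bounds the defect rows,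
`∫ K_β(U,V)(g(U) − g(V))² dV ≤ M` for every `U`, then `⟨gη, K_β(gη)⟩ ≥ ⟨g²η, K_β η⟩ − ½ M ‖η‖²`
(`η(U)η(V) ≤ ½(η(U)² + η(V)²)` against the non-negative weight `K·(g(U)−g(V))²`, and its `U ↔ V` symmetry). [cite: SimonB1983DiscreteSpectrum, §3] -/
theorem qform_mul_mul_ge {L : ℕ} [NeZero L] (hρ : Continuous ρ) (β : ℝ)
    (hsymm : ∀ U V : GaugeConfig 3 L G, transferKernel ρ β U V = transferKernel ρ β V U)
    {g : GaugeConfig 3 L G → ℝ} (hgm : Measurable g) {Cg : ℝ} (hgb : ∀ U, |g U| ≤ Cg)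
    (hgg : ∀ (k : Site 3 L → G) (U : GaugeConfig 3 L G), g (gaugeTransform k U) = g U)
    (hgz : ∀ (k : Fin 3), ∀ z ∈ Subgroup.center G, ∀ U : GaugeConfig 3 L G, g (twist k z U) = g U)
    {M : ℝ} (hM : ∀ U : GaugeConfig 3 L G,
      ∫ V, transferKernel ρ β U V * (g U - g V) ^ 2 ∂configMeasure G L ≤ M)
    {η : GaugeConfig 3 L G → ℝ} (hη : IsPhys η) :
    qform ρ β (fun U => g U ^ 2 * η U) η - (1 / 2) * M * l2 η η
      ≤ qform ρ β (fun U => g U * η U) (fun U => g U * η U) := by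
  set μ := configMeasure G L with hμ
  set Pm := μ.prod μ with hPm
  set K : GaugeConfig 3 L G × GaugeConfig 3 L G → ℝ := fun p => transferKernel ρ β p.1 p.2 with hK
  set D : GaugeConfig 3 L G × GaugeConfig 3 L G → ℝ := fun p => (g p.1 - g p.2) ^ 2 with hD
  have hCg : 0 ≤ Cg := (abs_nonneg _).trans (hgb (1 : GaugeConfig 3 L G))
  obtain ⟨C, hC⟩ := hη.bounded
  obtain ⟨Mk, hMk⟩ := exists_transferKernel_le ρ hρ β (L := L)
  have hD0 : ∀ p, 0 ≤ D p := fun p => sq_nonneg _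
  have hDm : Measurable D := ((hgm.comp measurable_fst).sub (hgm.comp measurable_snd)).pow_const 2
  have hDb : ∀ p : GaugeConfig 3 L G × GaugeConfig 3 L G, |D p| ≤ (2 * Cg) ^ 2 := fun p => by
    rw [hD, abs_pow]
    refine pow_le_pow_left₀ (abs_nonneg _) ((abs_sub _ _).trans ?_) 2
    linarith [hgb p.1, hgb p.2]
  have hKD_symm : ∀ p : GaugeConfig 3 L G × GaugeConfig 3 L G, K p.swap * D p.swap = K p * D p := by
    intro p
    simp only [hK, hD, Prod.fst_swap, Prod.snd_swap]
    rw [hsymm p.2 p.1]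
    ring
  -- the identity
  have hid := qform_mul_mul_eq ρ hρ β hsymm hgm hgb hgg hgz hη
  -- the remainder `R = ∫ η(U)Kη(V)D` is at most `∫ η(U)² K D`
  have hKm : AEStronglyMeasurable K Pm := (continuous_transferKernel ρ hρ β).aestronglyMeasurable
  have hsqU : Integrable (fun p : GaugeConfig 3 L G × GaugeConfig 3 L G => η p.1 ^ 2 * (K p * D p)) Pm := by
    have hm : AEStronglyMeasurable (fun p : GaugeConfig 3 L G × GaugeConfig 3 L G => η p.1 ^ 2 * (K p * D p)) Pm :=
      ((hη.measurable.comp measurable_fst).pow_const 2).aestronglyMeasurable.mul (hKm.mul hDm.aestronglyMeasurable)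
    refine integrable_prod_of_bounded hm (C := C ^ 2 * (Mk * (2 * Cg) ^ 2)) fun p => ?_
    have hK0 : 0 < K p := transferKernel_pos ρ β p.1 p.2
    rw [abs_mul, abs_mul, abs_of_pos hK0, abs_pow]
    refine mul_le_mul (pow_le_pow_left₀ (abs_nonneg _) (hC p.1) 2) ?_ (by positivity) (by positivity)
    exact mul_le_mul (hMk p.1 p.2) (hDb p) (abs_nonneg _) (hK0.le.trans (hMk p.1 p.2))
  have hsqV : Integrable (fun p : GaugeConfig 3 L G × GaugeConfig 3 L G => η p.2 ^ 2 * (K p * D p)) Pm := by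
    have hm : AEStronglyMeasurable (fun p : GaugeConfig 3 L G × GaugeConfig 3 L G => η p.2 ^ 2 * (K p * D p)) Pm :=
      ((hη.measurable.comp measurable_snd).pow_const 2).aestronglyMeasurable.mul (hKm.mul hDm.aestronglyMeasurable)
    refine integrable_prod_of_bounded hm (C := C ^ 2 * (Mk * (2 * Cg) ^ 2)) fun p => ?_
    have hK0 : 0 < K p := transferKernel_pos ρ β p.1 p.2
    rw [abs_mul, abs_mul, abs_of_pos hK0, abs_pow]
    refine mul_le_mul (pow_le_pow_left₀ (abs_nonneg _) (hC p.2) 2) ?_ (by positivity) (by positivity)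
    exact mul_le_mul (hMk p.1 p.2) (hDb p) (abs_nonneg _) (hK0.le.trans (hMk p.1 p.2))
  -- symmetry: `∫ η(V)² K D = ∫ η(U)² K D`
  have hswap : ∫ p, η p.2 ^ 2 * (K p * D p) ∂Pm = ∫ p, η p.1 ^ 2 * (K p * D p) ∂Pm := by
    have h := integral_prod_swap (μ := μ) (ν := μ)
      (fun p : GaugeConfig 3 L G × GaugeConfig 3 L G => η p.1 ^ 2 * (K p * D p))
    rw [← h]
    refine integral_congr_ae (ae_of_all _ fun p => ?_)
    simp only [Prod.fst_swap]
    rw [hKD_symm p]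
  have hR : ∫ p, η p.1 * transferKernel ρ β p.1 p.2 * η p.2 * (g p.1 - g p.2) ^ 2 ∂Pm
      ≤ ∫ p, η p.1 ^ 2 * (K p * D p) ∂Pm := by
    have hle : ∫ p, η p.1 * transferKernel ρ β p.1 p.2 * η p.2 * (g p.1 - g p.2) ^ 2 ∂Pm
        ≤ ∫ p, ((1 / 2) * (η p.1 ^ 2 * (K p * D p)) + (1 / 2) * (η p.2 ^ 2 * (K p * D p))) ∂Pm := by
      refine integral_mono (integrable_qformIntegrand_mul ρ hρ β hη hη hDm hDb)
        ((hsqU.const_mul _).add (hsqV.const_mul _)) fun p => ?_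
      have hw : 0 ≤ K p * D p := mul_nonneg (transferKernel_pos ρ β p.1 p.2).le (hD0 p)
      have h2 : η p.1 * η p.2 ≤ (1 / 2) * (η p.1 ^ 2 + η p.2 ^ 2) := by nlinarith [sq_nonneg (η p.1 - η p.2)]
      calc η p.1 * transferKernel ρ β p.1 p.2 * η p.2 * (g p.1 - g p.2) ^ 2
          = (η p.1 * η p.2) * (K p * D p) := by simp only [hK, hD]; ring
        _ ≤ (1 / 2) * (η p.1 ^ 2 + η p.2 ^ 2) * (K p * D p) := mul_le_mul_of_nonneg_right h2 hw
        _ = (1 / 2) * (η p.1 ^ 2 * (K p * D p)) + (1 / 2) * (η p.2 ^ 2 * (K p * D p)) := by ring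
    rw [integral_add (hsqU.const_mul _) (hsqV.const_mul _), integral_const_mul, integral_const_mul, hswap] at hle
    linarith
  -- `∫ η(U)² K D d(μ⊗μ) = ∫ η(U)² (∫ K D dV) dU ≤ M ‖η‖²`
  have hrow : ∫ p, η p.1 ^ 2 * (K p * D p) ∂Pm ≤ M * l2 η η := by
    rw [integral_prod _ hsqU]
    have hl2 : l2 η η = ∫ U, η U ^ 2 ∂μ := by simp only [l2, pow_two, hμ]
    rw [hl2, ← integral_const_mul]
    refine integral_mono_of_nonneg (ae_of_all _ fun U => ?_) ((hη.integrable_sq).const_mul M) (ae_of_all _ fun U => ?_)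
    · exact integral_nonneg fun V => mul_nonneg (sq_nonneg _)
        (mul_nonneg (transferKernel_pos ρ β _ _).le (hD0 (U, V)))
    · show ∫ V, η (U, V).1 ^ 2 * (K (U, V) * D (U, V)) ∂μ ≤ M * η U ^ 2
      simp only
      rw [integral_const_mul, mul_comm]
      exact mul_le_mul_of_nonneg_right (hM U) (sq_nonneg _)
  rw [hid]
  have h12 : (0 : ℝ) ≤ 1 / 2 := by norm_num
  nlinarith [mul_le_mul_of_nonneg_left (hR.trans hrow) h12]

omit [SecondCountableTopology G] in
/-- `‖gη‖² = ⟨g²η, η⟩` (pointwise `(gη)(gη) = (g²η)η`). [folklore] -/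
theorem l2_mul_mul_eq {L : ℕ} [NeZero L] (g η : GaugeConfig 3 L G → ℝ) :
    l2 (fun U => g U * η U) (fun U => g U * η U) = l2 (fun U => g U ^ 2 * η U) η := by
  unfold l2
  exact integral_congr_ae (ae_of_all _ fun U => by ring)

/-- ★ **The energy functional of a product, exactly.**  With `P_s(u) := s‖u‖² − ⟨u,K_βu⟩` (`s` any level, e.g. the top value `μ₀`):
`P_s(gη) = (s⟨g²η,η⟩ − ⟨g²η,K_βη⟩) + ½ ∫∫ η(U)K_β(U,V)η(V)(g(U) − g(V))² d(μ⊗μ)`. [cite: SimonB1983DiscreteSpectrum, §3] [cite: Luscher1983, §3] -/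
theorem energy_mul_eq {L : ℕ} [NeZero L] (hρ : Continuous ρ) (β : ℝ)
    (hsymm : ∀ U V : GaugeConfig 3 L G, transferKernel ρ β U V = transferKernel ρ β V U)
    {g : GaugeConfig 3 L G → ℝ} (hgm : Measurable g) {Cg : ℝ} (hgb : ∀ U, |g U| ≤ Cg)
    (hgg : ∀ (k : Site 3 L → G) (U : GaugeConfig 3 L G), g (gaugeTransform k U) = g U)
    (hgz : ∀ (k : Fin 3), ∀ z ∈ Subgroup.center G, ∀ U : GaugeConfig 3 L G, g (twist k z U) = g U)
    {η : GaugeConfig 3 L G → ℝ} (hη : IsPhys η) (s : ℝ) :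
    s * l2 (fun U => g U * η U) (fun U => g U * η U) - qform ρ β (fun U => g U * η U) (fun U => g U * η U)
      = (s * l2 (fun U => g U ^ 2 * η U) η - qform ρ β (fun U => g U ^ 2 * η U) η)
        + (1 / 2) * ∫ p, η p.1 * transferKernel ρ β p.1 p.2 * η p.2 * (g p.1 - g p.2) ^ 2
            ∂(configMeasure G L).prod (configMeasure G L) := by
  rw [l2_mul_mul_eq, qform_mul_mul_eq ρ hρ β hsymm hgm hgb hgg hgz hη]
  ring

/-- ★ **The energy functional of a product, bounded** (the SOFT-ERROR estimate of the r6 plan, step (d), before inserting the link-moment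
bound for `M`): `P_s(gη) ≤ (s⟨g²η,η⟩ − ⟨g²η,K_βη⟩) + ½ M ‖η‖²` whenever `∫ K_β(U,V)(g(U) − g(V))² dV ≤ M` for all `U`.
[cite: SimonB1983DiscreteSpectrum, §3] [cite: Luscher1983, §3] -/
theorem energy_mul_le {L : ℕ} [NeZero L] (hρ : Continuous ρ) (β : ℝ)
    (hsymm : ∀ U V : GaugeConfig 3 L G, transferKernel ρ β U V = transferKernel ρ β V U)
    {g : GaugeConfig 3 L G → ℝ} (hgm : Measurable g) {Cg : ℝ} (hgb : ∀ U, |g U| ≤ Cg)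
    (hgg : ∀ (k : Site 3 L → G) (U : GaugeConfig 3 L G), g (gaugeTransform k U) = g U)
    (hgz : ∀ (k : Fin 3), ∀ z ∈ Subgroup.center G, ∀ U : GaugeConfig 3 L G, g (twist k z U) = g U)
    {M : ℝ} (hM : ∀ U : GaugeConfig 3 L G,
      ∫ V, transferKernel ρ β U V * (g U - g V) ^ 2 ∂configMeasure G L ≤ M)
    {η : GaugeConfig 3 L G → ℝ} (hη : IsPhys η) (s : ℝ) :
    s * l2 (fun U => g U * η U) (fun U => g U * η U) - qform ρ β (fun U => g U * η U) (fun U => g U * η U)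
      ≤ (s * l2 (fun U => g U ^ 2 * η U) η - qform ρ β (fun U => g U ^ 2 * η U) η) + (1 / 2) * M * l2 η η := by
  have h := qform_mul_mul_ge ρ hρ β hsymm hgm hgb hgg hgz hM hη
  rw [l2_mul_mul_eq]
  linarith

end Generic

/-! ### §2. The `SU(2)` kernel of the leaves: symmetric, operator currency `⟨g²η, K_βη⟩ = ⟨g²η, transferApply β η⟩_{L²}` -/

section SU2

variable {L : ℕ} [NeZero L]

/-- ★ **Product identity, `SU(2)` leaves, operator currency**: for a bounded measurable gauge- and twist-invariant multiplier `g` and a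
physical `η`, with `T = transferApply β`:
`s‖gη‖² − ⟨gη, K_β(gη)⟩ = ⟨g²η, sη⟩ − ⟨g²η, Tη⟩ + ½ ∫∫ ηK_βη (g(U) − g(V))²` — written as
`s·l2(g²η,η) − l2(g²η, Tη) + ½∫∫…`. [cite: Luscher1983, §3] [cite: SimonB1983DiscreteSpectrum, §3] -/
theorem energy_mul_eq_su2 (β : ℝ) {g : GaugeConfig 3 L SU2 → ℝ} (hgm : Measurable g) {Cg : ℝ} (hgb : ∀ U, |g U| ≤ Cg)
    (hgg : ∀ (k : Site 3 L → SU2) (U : GaugeConfig 3 L SU2), g (gaugeTransform k U) = g U)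
    (hgz : ∀ (k : Fin 3), ∀ z ∈ Subgroup.center SU2, ∀ U : GaugeConfig 3 L SU2, g (twist k z U) = g U)
    {η : GaugeConfig 3 L SU2 → ℝ} (hη : IsPhys η) (s : ℝ) :
    s * l2 (fun U => g U * η U) (fun U => g U * η U) - qform su2Rep β (fun U => g U * η U) (fun U => g U * η U)
      = (s * l2 (fun U => g U ^ 2 * η U) η - l2 (fun U => g U ^ 2 * η U) (transferApply β η))
        + (1 / 2) * ∫ p, η p.1 * transferKernel su2Rep β p.1 p.2 * η p.2 * (g p.1 - g p.2) ^ 2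
            ∂(configMeasure SU2 L).prod (configMeasure SU2 L) := by
  haveI : SecondCountableTopology SU2 := secondCountableTopology_su2
  rw [← qform_eq_l2_transferApply]
  exact energy_mul_eq su2Rep continuous_su2Rep β (transferKernel_su2Rep_symm β) hgm hgb hgg hgz hη s

/-- ★ **Product inequality, `SU(2)` leaves, operator currency**: with a defect-row bound `∫ K_β(U,V)(g(U) − g(V))² dV ≤ M`,
`s‖gη‖² − ⟨gη, K_β(gη)⟩ ≤ s·l2(g²η,η) − l2(g²η, transferApply β η) + ½ M ‖η‖²`. [cite: Luscher1983, §3] [cite: SimonB1983DiscreteSpectrum, §3] -/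
theorem energy_mul_le_su2 (β : ℝ) {g : GaugeConfig 3 L SU2 → ℝ} (hgm : Measurable g) {Cg : ℝ} (hgb : ∀ U, |g U| ≤ Cg)
    (hgg : ∀ (k : Site 3 L → SU2) (U : GaugeConfig 3 L SU2), g (gaugeTransform k U) = g U)
    (hgz : ∀ (k : Fin 3), ∀ z ∈ Subgroup.center SU2, ∀ U : GaugeConfig 3 L SU2, g (twist k z U) = g U)
    {M : ℝ} (hM : ∀ U : GaugeConfig 3 L SU2,
      ∫ V, transferKernel su2Rep β U V * (g U - g V) ^ 2 ∂configMeasure SU2 L ≤ M)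
    {η : GaugeConfig 3 L SU2 → ℝ} (hη : IsPhys η) (s : ℝ) :
    s * l2 (fun U => g U * η U) (fun U => g U * η U) - qform su2Rep β (fun U => g U * η U) (fun U => g U * η U)
      ≤ (s * l2 (fun U => g U ^ 2 * η U) η - l2 (fun U => g U ^ 2 * η U) (transferApply β η)) + (1 / 2) * M * l2 η η := by
  haveI : SecondCountableTopology SU2 := secondCountableTopology_su2
  rw [← qform_eq_l2_transferApply]
  exact energy_mul_le su2Rep continuous_su2Rep β (transferKernel_su2Rep_symm β) hgm hgb hgg hgz hM hη s

/-- The `SU(2)` product identity in form currency (`qform_mul_mul_eq` specialised). [cite: SimonB1983DiscreteSpectrum, §3] -/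
theorem qform_mul_mul_eq_su2 (β : ℝ) {g : GaugeConfig 3 L SU2 → ℝ} (hgm : Measurable g) {Cg : ℝ} (hgb : ∀ U, |g U| ≤ Cg)
    (hgg : ∀ (k : Site 3 L → SU2) (U : GaugeConfig 3 L SU2), g (gaugeTransform k U) = g U)
    (hgz : ∀ (k : Fin 3), ∀ z ∈ Subgroup.center SU2, ∀ U : GaugeConfig 3 L SU2, g (twist k z U) = g U)
    {η : GaugeConfig 3 L SU2 → ℝ} (hη : IsPhys η) :
    qform su2Rep β (fun U => g U * η U) (fun U => g U * η U)
      = qform su2Rep β (fun U => g U ^ 2 * η U) η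
        - (1 / 2) * ∫ p, η p.1 * transferKernel su2Rep β p.1 p.2 * η p.2 * (g p.1 - g p.2) ^ 2
            ∂(configMeasure SU2 L).prod (configMeasure SU2 L) := by
  haveI : SecondCountableTopology SU2 := secondCountableTopology_su2
  exact qform_mul_mul_eq su2Rep continuous_su2Rep β (transferKernel_su2Rep_symm β) hgm hgb hgg hgz hη

end SU2

end Summit.QuantumFields.YangMills.Theorems.FemtoTransferGap

end
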